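import Literature.Analysis.ValidatedNumerics.MultiPrecisionInterval
import HarnessLib

/-!
# rh-explicit (venture WeilGRH): conductor boxes — one `log q` enclosure for a whole range of moduli (weil-3 gen18)

Cell `rh-explicit`, WEIL TRACK (structure seat weil-3, gen18).  The twisted Christoffel certificates of the prime-free rung depend on the
modulus `q` only through an enclosure `LQ` of `log q` (`TwistedChristoffelCertificate`, hypothesis `MI.mem S (log q) LQ`).  Since `log`
is monotone, the outer hull of the `MI.logNat` enclosures of two endpoints `q₀ ≤ q₁` contains `log q` for EVERY `q₀ ≤ q ≤ q₁`
(`mem_log_box`, `mem_log_box_of_logNat`): one kernel certificate checked with such a wide box holds for the whole range of conductors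
(`RigidityCharFloorA03465P7–P13`: 26 boxes cover `5 ≤ q ≤ 10^100`).  Pure interval bookkeeping; standard axioms.
-/

set_option autoImplicit false

namespace Summit.Ventures.WeilGRH.ConductorBox

open Literature.Analysis.ValidatedNumerics.NumericsMP

/-- ★ **Conductor boxes**: if `log q₀ ∈ Y₀` and `log q₁ ∈ Y₁` (at scale `S`) then `log q ∈ [Y₀.lo, Y₁.hi]` for every `q₀ ≤ q ≤ q₁`. -/
theorem mem_log_box {S : ℕ} {q₀ q₁ q : ℕ} (hq₀ : 0 < q₀) (h₀ : q₀ ≤ q) (h₁ : q ≤ q₁) {Y₀ Y₁ : MI}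
    (hm₀ : MI.mem S (Real.log q₀) Y₀) (hm₁ : MI.mem S (Real.log q₁) Y₁) :
    MI.mem S (Real.log q) ⟨Y₀.lo, Y₁.hi⟩ := by
  have hq : (0 : ℝ) < q := by exact_mod_cast lt_of_lt_of_le hq₀ h₀
  have hq0 : (0 : ℝ) < q₀ := by exact_mod_cast hq₀
  have l₀ : Real.log q₀ ≤ Real.log q := Real.log_le_log hq0 (by exact_mod_cast h₀)
  have l₁ : Real.log q ≤ Real.log q₁ := Real.log_le_log hq (by exact_mod_cast h₁)
  have hS : (0 : ℝ) ≤ S := by positivity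
  exact ⟨hm₀.1.trans (mul_le_mul_of_nonneg_right l₀ hS), (mul_le_mul_of_nonneg_right l₁ hS).trans hm₁.2⟩

/-- The same with the endpoints' enclosures produced by `MI.logNat` (success recorded as `isSome`, e.g. by `decide +kernel`):
`log q ∈ [(logNat q₀).lo, (logNat q₁).hi]` for every `q₀ ≤ q ≤ q₁`. -/
theorem mem_log_box_of_logNat {S K : ℕ} (hS : 0 < S) {q₀ q₁ q : ℕ} (hq₀ : 0 < q₀) (h₀ : q₀ ≤ q) (h₁ : q ≤ q₁)
    (hs₀ : (MI.logNat S K q₀).isSome = true) (hs₁ : (MI.logNat S K q₁).isSome = true) :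
    MI.mem S (Real.log q) ⟨((MI.logNat S K q₀).getD default).lo, ((MI.logNat S K q₁).getD default).hi⟩ := by
  have e₀ : MI.logNat S K q₀ = some ((MI.logNat S K q₀).getD default) := by
    cases h : MI.logNat S K q₀ with
    | none => rw [h] at hs₀; exact absurd hs₀ (by simp)
    | some Y => rfl
  have e₁ : MI.logNat S K q₁ = some ((MI.logNat S K q₁).getD default) := by
    cases h : MI.logNat S K q₁ with
    | none => rw [h] at hs₁; exact absurd hs₁ (by simp)
    | some Y => rfl
  exact mem_log_box hq₀ h₀ h₁ (MI.mem_logNat hS e₀) (MI.mem_logNat hS e₁)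

end Summit.Ventures.WeilGRH.ConductorBox
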